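import Literature.Barriers.CriticalPhenomena.LaceExpansionSymbolCalculus
import Mathlib.Analysis.Calculus.IteratedDeriv.Lemmas
import Mathlib.Analysis.Calculus.Deriv.Shift
import HarnessLib

/-!
# One-axis calculus of symbols on `ℝ^d`: slice derivatives, the reciprocal recursion, and the
# Leibniz expansion of `∂_l^n [E/((A + a)(F + b))]`

Barrier catalogue `Literature/Barriers/CriticalPhenomena/` (D-0021), infrastructure for the proof
of the named fact `SpreadOutIsing.LiuSlade2026_thm22` (Liu–Slade 2026, Theorem 2.2). Its
Proposition 3.2 differentiates `f̂ = Ê/(ÂF̂)` `n_d` times: "Since `f̂ = Ê/(ÂF̂)`, the `α`-th weak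
derivative of `f̂` is given by a linear combination of terms of the form
`(Π_n Â_{δ_n}/Â)(Ê_{α₂}/(ÂF̂))(Π_m F̂_{γ_m}/F̂)` (3.10)". In Lean the derivatives are taken
CLASSICALLY in one coordinate direction `e_l` (which is all the one-axis form of Lemma 3.1
consumes) on smooth symbols with massive denominators `A + a`, `F + b`; this file is the pure
calculus of that computation, for abstract families of symbols `A j, F j, E j : ℝ^d → ℝ`
(`j = 0, 1, 2, …`) in which `A (j+1)` is the slice derivative of `A j` in the direction `e_l`:

* `sliceFun l Φ k = (s ↦ Φ(k[l↦s]))` and `sliceIterDeriv l m Φ k = (d/ds)^m Φ(k[l↦s])|_{s=k_l}`;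
  under the chain hypothesis: `iteratedDeriv i (sliceFun l (A j) k) = sliceFun l (A (j+i)) k`,
  smoothness of the slices, `sliceIterDeriv l i (A 0) = A i`;
* `recipFactor l A a j = (A 0 + a) · ∂_l^j (A 0 + a)⁻¹` — the dimensionless factors of the
  derivatives of a reciprocal — and **the reciprocal recursion** (`recipFactor_eq_neg_sum`, from
  the tree's `mul_iteratedDeriv_inv_eq`): for `j ≥ 1`,
  `recipFactor j = -Σ_{i<j} C(j,i+1) (A (i+1)/(A 0 + a)) recipFactor (j-1-i)`, whence a polynomial in
  the blocks `A_δ/(A + a)`; continuity (`continuous_recipFactor`);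
* **the Leibniz expansion** (`sliceIterDeriv_quotient_eq_sum`):
  `∂_l^n [E 0/((A 0 + a)(F 0 + b))] = Σ_{i ≤ n} Σ_{j ≤ n-i} C(n,i) C(n-i,j) · E i · (recipFactor_A j/(A 0 + a)) · (recipFactor_F (n-i-j)/(F 0 + b))`
  — the source's "linear combination of terms of the form (3.10)";
* the chain and periodicity properties of `m ↦ sliceIterDeriv l m Φ` for a symbol with smooth,
  `2π`-periodic slices (`hasDerivAt_sliceFun_sliceIterDeriv`, `sliceIterDeriv_update_neg_pi`), the
  hypotheses of the character-tested integration by parts `integral_cube_cexp_mul_iterate_slice_deriv`.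

## References

* Y. Liu, G. Slade, *Gaussian deconvolution and the lace expansion for spread-out models*,
  Ann. Inst. H. Poincaré Probab. Statist. 62 (2026), arXiv:2310.07640: §3.1, (3.10) and the
  proof of Proposition 3.2 ("We use the product and quotient rules … to calculate `f̂_α`")
  [LiuSlade2026].
-/

noncomputable section

namespace Literature.Barriers.CriticalPhenomena

open Finset
open scoped BigOperators

variable {d : ℕ}

/-! ## Slices and slice derivatives -/

/-- The slice `s ↦ Φ(k[l↦s])` of a symbol `Φ` on `ℝ^d` through `k` in the coordinate direction `e_l`.
[cite: LiuSlade2026, §3.1 (∇^α with α = m e_l: derivatives in one coordinate direction)] -/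
def sliceFun (l : Fin d) (Φ : (Fin d → ℝ) → ℝ) (k : Fin d → ℝ) : ℝ → ℝ := fun s => Φ (Function.update k l s)

/-- The `m`-th derivative of `Φ` in the direction `e_l` at `k`: `(d/ds)^m Φ(k[l↦s])|_{s = k_l}`.
[cite: LiuSlade2026, §3.1 (Ê_α = ∇^α Ê for a multi-index α; here α = m e_l)] -/
def sliceIterDeriv (l : Fin d) (m : ℕ) (Φ : (Fin d → ℝ) → ℝ) (k : Fin d → ℝ) : ℝ :=
  iteratedDeriv m (sliceFun l Φ k) (k l)

section Basic

variable (l : Fin d) (Φ : (Fin d → ℝ) → ℝ) (k : Fin d → ℝ)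

/-- `sliceFun` unfolded. [folklore] -/
theorem sliceFun_apply (s : ℝ) : sliceFun l Φ k s = Φ (Function.update k l s) := rfl

/-- The slice through `k[l↦s₀]` is the slice through `k`. [folklore] -/
theorem sliceFun_update (s₀ : ℝ) : sliceFun l Φ (Function.update k l s₀) = sliceFun l Φ k := by
  funext s; simp [sliceFun, Function.update_idem]

/-- The slice through `k` passes through `k` at `s = k_l`. [folklore] -/
theorem sliceFun_self : sliceFun l Φ k (k l) = Φ k := by simp [sliceFun]

/-- Order zero. [folklore] -/
theorem sliceIterDeriv_zero : sliceIterDeriv l 0 Φ k = Φ k := by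
  simp [sliceIterDeriv, sliceFun_self]

/-- Along the slice, `sliceIterDeriv` is the iterated derivative of the slice function. [folklore] -/
theorem sliceIterDeriv_update (m : ℕ) (s : ℝ) :
    sliceIterDeriv l m Φ (Function.update k l s) = iteratedDeriv m (sliceFun l Φ k) s := by
  simp [sliceIterDeriv, sliceFun_update]

/-- Hence the slice of `sliceIterDeriv l m Φ` is `iteratedDeriv m` of the slice of `Φ`. [folklore] -/
theorem sliceFun_sliceIterDeriv (m : ℕ) :
    sliceFun l (sliceIterDeriv l m Φ) k = iteratedDeriv m (sliceFun l Φ k) :=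
  funext fun s => sliceIterDeriv_update l Φ k m s

end Basic

/-! ## Families closed under the slice derivative -/

section Chain

variable {l : Fin d} {A : ℕ → (Fin d → ℝ) → ℝ}

/-- Under the chain hypothesis `(d/ds) A j (k[l↦s])|_{s=k_l} = A (j+1) k` (at every `k`), the slice
of `A j` has derivative the slice of `A (j+1)` at every point. [folklore] -/
theorem hasDerivAt_sliceFun_of_chain
    (hA : ∀ j k, HasDerivAt (sliceFun l (A j) k) (A (j + 1) k) (k l)) (j : ℕ) (k : Fin d → ℝ)
    (s : ℝ) : HasDerivAt (sliceFun l (A j) k) (A (j + 1) (Function.update k l s)) s := by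
  have h := hA j (Function.update k l s)
  rwa [sliceFun_update, Function.update_self] at h

/-- `deriv (slice of A j) = slice of A (j+1)`. [folklore] -/
theorem deriv_sliceFun_of_chain
    (hA : ∀ j k, HasDerivAt (sliceFun l (A j) k) (A (j + 1) k) (k l)) (j : ℕ) (k : Fin d → ℝ) :
    deriv (sliceFun l (A j) k) = sliceFun l (A (j + 1)) k :=
  funext fun s => (hasDerivAt_sliceFun_of_chain hA j k s).deriv

/-- `iteratedDeriv i (slice of A j) = slice of A (j+i)`. [folklore] -/
theorem iteratedDeriv_sliceFun_of_chain
    (hA : ∀ j k, HasDerivAt (sliceFun l (A j) k) (A (j + 1) k) (k l)) (i j : ℕ) (k : Fin d → ℝ) :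
    iteratedDeriv i (sliceFun l (A j) k) = sliceFun l (A (j + i)) k := by
  induction i generalizing j with
  | zero => simp
  | succ i ih =>
    rw [iteratedDeriv_succ', deriv_sliceFun_of_chain hA, ih (j + 1)]
    congr 2; ring

/-- The slices are differentiable. [folklore] -/
theorem differentiable_sliceFun_of_chain
    (hA : ∀ j k, HasDerivAt (sliceFun l (A j) k) (A (j + 1) k) (k l)) (j : ℕ) (k : Fin d → ℝ) :
    Differentiable ℝ (sliceFun l (A j) k) := fun s =>
  (hasDerivAt_sliceFun_of_chain hA j k s).differentiableAt

/-- The slices are smooth (every order). [folklore] -/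
theorem contDiff_sliceFun_of_chain
    (hA : ∀ j k, HasDerivAt (sliceFun l (A j) k) (A (j + 1) k) (k l)) (n : ℕ∞) (j : ℕ)
    (k : Fin d → ℝ) : ContDiff ℝ n (sliceFun l (A j) k) :=
  contDiff_of_differentiable_iteratedDeriv fun m _ => by
    rw [iteratedDeriv_sliceFun_of_chain hA]
    exact differentiable_sliceFun_of_chain hA _ _

/-- **`sliceIterDeriv l i (A 0) = A i`**. [folklore] -/
theorem sliceIterDeriv_of_chain
    (hA : ∀ j k, HasDerivAt (sliceFun l (A j) k) (A (j + 1) k) (k l)) (i : ℕ) (k : Fin d → ℝ) :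
    sliceIterDeriv l i (A 0) k = A i k := by
  rw [sliceIterDeriv, iteratedDeriv_sliceFun_of_chain hA, zero_add, sliceFun_self]

/-! ### The massive symbol `A 0 + a` -/

/-- The slice of `A 0 + a`. [folklore] -/
theorem sliceFun_add_const (a : ℝ) (k : Fin d → ℝ) :
    sliceFun l (fun k => A 0 k + a) k = fun s => sliceFun l (A 0) k s + a := rfl

/-- The derivatives of order `≥ 1` of the slice of `A 0 + a` are the slices of the `A i`. [folklore] -/
theorem iteratedDeriv_succ_sliceFun_add_const
    (hA : ∀ j k, HasDerivAt (sliceFun l (A j) k) (A (j + 1) k) (k l)) (a : ℝ) (i : ℕ)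
    (k : Fin d → ℝ) :
    iteratedDeriv (i + 1) (sliceFun l (fun k => A 0 k + a) k) = sliceFun l (A (i + 1)) k := by
  rw [iteratedDeriv_succ', sliceFun_add_const]
  have h : deriv (fun s => sliceFun l (A 0) k s + a) = deriv (sliceFun l (A 0) k) :=
    funext fun s => deriv_add_const a
  rw [h, deriv_sliceFun_of_chain hA, iteratedDeriv_sliceFun_of_chain hA]
  congr 2; ring

/-- The slice of `A 0 + a` is smooth. [folklore] -/
theorem contDiff_sliceFun_add_const
    (hA : ∀ j k, HasDerivAt (sliceFun l (A j) k) (A (j + 1) k) (k l)) (n : ℕ∞) (a : ℝ)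
    (k : Fin d → ℝ) : ContDiff ℝ n (sliceFun l (fun k => A 0 k + a) k) := by
  rw [sliceFun_add_const]
  exact (contDiff_sliceFun_of_chain hA n 0 k).add contDiff_const

end Chain

/-! ## The reciprocal recursion -/

/-- The dimensionless factor `g_j = (A 0 + a) · ∂_l^j (A 0 + a)⁻¹` of the `j`-th derivative of the
reciprocal of the massive symbol `A 0 + a` (`∂_l^j (A+a)⁻¹ = g_j/(A+a)`).
[cite: LiuSlade2026, (3.10) (the factors Π_n Â_{δ_n}/Â of the derivatives of 1/Â)] -/
def recipFactor (l : Fin d) (A : ℕ → (Fin d → ℝ) → ℝ) (a : ℝ) (j : ℕ) (k : Fin d → ℝ) : ℝ :=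
  (A 0 k + a) * sliceIterDeriv l j (fun k => (A 0 k + a)⁻¹) k

section Recip

variable {l : Fin d} {A : ℕ → (Fin d → ℝ) → ℝ} {a : ℝ}

/-- `g_0 = 1`. [folklore] -/
theorem recipFactor_zero (hne : ∀ k, A 0 k + a ≠ 0) (k : Fin d → ℝ) : recipFactor l A a 0 k = 1 := by
  rw [recipFactor, sliceIterDeriv_zero, mul_inv_cancel₀ (hne k)]

/-- `∂_l^j (A+a)⁻¹ = g_j/(A+a)`. [folklore] -/
theorem sliceIterDeriv_inv_eq (hne : ∀ k, A 0 k + a ≠ 0) (j : ℕ) (k : Fin d → ℝ) :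
    sliceIterDeriv l j (fun k => (A 0 k + a)⁻¹) k = recipFactor l A a j k / (A 0 k + a) := by
  rw [recipFactor]
  exact (mul_div_cancel_left₀ _ (hne k)).symm

/-- **The reciprocal recursion**: for `j ≥ 1`,
`g_j = -Σ_{i<j} C(j,i+1) (A (i+1)/(A 0 + a)) g_{j-1-i}` (the Leibniz identity for
`(A+a)·(A+a)⁻¹ = 1` solved for the top derivative; the tree's `mul_iteratedDeriv_inv_eq`).
[cite: LiuSlade2026, (3.10) and the proof of Proposition 3.2 (product and quotient rules)] -/
theorem recipFactor_eq_neg_sum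
    (hA : ∀ j k, HasDerivAt (sliceFun l (A j) k) (A (j + 1) k) (k l))
    (hne : ∀ k, A 0 k + a ≠ 0) {j : ℕ} (hj : 1 ≤ j) (k : Fin d → ℝ) :
    recipFactor l A a j k = -∑ i ∈ range j, (j.choose (i + 1) : ℝ) * (A (i + 1) k / (A 0 k + a)) *
      recipFactor l A a (j - (i + 1)) k := by
  set f : ℝ → ℝ := sliceFun l (fun k => A 0 k + a) k with hf
  have hfc : ContDiff ℝ j f := contDiff_sliceFun_add_const hA j a k
  have hfne : ∀ t, f t ≠ 0 := fun t => hne _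
  have h := mul_iteratedDeriv_inv_eq hfc hfne hj le_rfl (s := k l)
  -- identify the pieces
  have hf0 : f (k l) = A 0 k + a := sliceFun_self l _ k
  have hinv : (fun t => (f t)⁻¹) = sliceFun l (fun k => (A 0 k + a)⁻¹) k := rfl
  have hder : ∀ i, iteratedDeriv (i + 1) f (k l) = A (i + 1) k := fun i => by
    rw [hf, iteratedDeriv_succ_sliceFun_add_const hA, sliceFun_self]
  rw [hf0, hinv] at h
  have hL : (A 0 k + a) * iteratedDeriv j (sliceFun l (fun k => (A 0 k + a)⁻¹) k) (k l) =
      recipFactor l A a j k := rfl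
  rw [hL] at h
  rw [h]
  congr 1
  refine Finset.sum_congr rfl fun i _ => ?_
  rw [hder i]
  have hrec : iteratedDeriv (j - (i + 1)) (sliceFun l (fun k => (A 0 k + a)⁻¹) k) (k l) =
      recipFactor l A a (j - (i + 1)) k / (A 0 k + a) := sliceIterDeriv_inv_eq hne _ k
  rw [hrec]
  field_simp

/-- The factors `g_j` are continuous on `ℝ^d` when the `A i` are and `A 0 + a` does not vanish
(strong induction through the recursion). [folklore] -/
theorem continuous_recipFactor
    (hA : ∀ j k, HasDerivAt (sliceFun l (A j) k) (A (j + 1) k) (k l))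
    (hne : ∀ k, A 0 k + a ≠ 0) (hAc : ∀ j, Continuous (A j)) (j : ℕ) :
    Continuous (recipFactor l A a j) := by
  induction j using Nat.strong_induction_on with
  | _ j ih =>
    rcases Nat.eq_zero_or_pos j with hj | hj
    · subst hj
      have : recipFactor l A a 0 = fun _ => 1 := funext fun k => recipFactor_zero hne k
      rw [this]; exact continuous_const
    · have hfun : recipFactor l A a j = fun k => -∑ i ∈ range j, (j.choose (i + 1) : ℝ) *
          (A (i + 1) k / (A 0 k + a)) * recipFactor l A a (j - (i + 1)) k :=
        funext fun k => recipFactor_eq_neg_sum hA hne hj k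
      rw [hfun]
      refine Continuous.neg (continuous_finsetSum _ fun i hi => ?_)
      have hlt : j - (i + 1) < j := by
        have := Finset.mem_range.1 hi; omega
      exact ((continuous_const.mul ((hAc (i + 1)).div ((hAc 0).add continuous_const) hne)).mul (ih _ hlt))

end Recip

/-! ## The Leibniz expansion of `∂_l^n [E/((A+a)(F+b))]` -/

section Leibniz

variable {l : Fin d} {A F E : ℕ → (Fin d → ℝ) → ℝ} {a b : ℝ}

/-- **The `n`-th slice derivative of `u = E 0/((A 0 + a)(F 0 + b))`** as a double sum of products of
blocks: `∂_l^n u = Σ_{i ≤ n} Σ_{j ≤ n-i} C(n,i) C(n-i,j) · E i · (g^A_j/(A 0 + a)) · (g^F_{n-i-j}/(F 0 + b))`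
(`g^A_j = recipFactor l A a j`, a polynomial in the `A_δ/(A+a)` by the reciprocal recursion, and
likewise `g^F`), i.e. "a linear combination of terms of the form
`(Π Â_δ/Â)(Ê_{α₂}/(ÂF̂))(Π F̂_γ/F̂)`" (3.10). (Leibniz twice: `u = E 0 · [(A+a)⁻¹ · (F+b)⁻¹]`.)
[cite: LiuSlade2026, (3.10) and the proof of Proposition 3.2] -/
theorem sliceIterDeriv_quotient_eq_sum
    (hA : ∀ j k, HasDerivAt (sliceFun l (A j) k) (A (j + 1) k) (k l))
    (hF : ∀ j k, HasDerivAt (sliceFun l (F j) k) (F (j + 1) k) (k l))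
    (hE : ∀ j k, HasDerivAt (sliceFun l (E j) k) (E (j + 1) k) (k l))
    (hAne : ∀ k, A 0 k + a ≠ 0) (hFne : ∀ k, F 0 k + b ≠ 0) (n : ℕ) (k : Fin d → ℝ) :
    sliceIterDeriv l n (fun k => E 0 k / ((A 0 k + a) * (F 0 k + b))) k =
      ∑ i ∈ range (n + 1), ∑ j ∈ range (n - i + 1), (n.choose i : ℝ) * ((n - i).choose j : ℝ) *
        E i k * (recipFactor l A a j k / (A 0 k + a)) * (recipFactor l F b (n - i - j) k / (F 0 k + b)) := by
  -- the three slices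
  set e : ℝ → ℝ := sliceFun l (E 0) k with he
  set gA : ℝ → ℝ := sliceFun l (fun k => (A 0 k + a)⁻¹) k with hgA
  set gF : ℝ → ℝ := sliceFun l (fun k => (F 0 k + b)⁻¹) k with hgF
  have hec : ContDiff ℝ n e := contDiff_sliceFun_of_chain hE n 0 k
  have hgAc : ContDiff ℝ n gA :=
    (contDiff_sliceFun_add_const hA n a k).inv fun t => hAne _
  have hgFc : ContDiff ℝ n gF :=
    (contDiff_sliceFun_add_const hF n b k).inv fun t => hFne _
  have hu : sliceFun l (fun k => E 0 k / ((A 0 k + a) * (F 0 k + b))) k = fun s => e s * (gA s * gF s) := by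
    funext s
    simp only [he, hgA, hgF, sliceFun_apply]
    rw [div_eq_mul_inv, mul_inv]
  rw [sliceIterDeriv, hu, iteratedDeriv_fun_mul hec.contDiffAt (hgAc.mul hgFc).contDiffAt]
  refine Finset.sum_congr rfl fun i hi => ?_
  have hi' : i ≤ n := Nat.lt_succ_iff.1 (Finset.mem_range.1 hi)
  -- `iteratedDeriv i e (k l) = E i k`
  have hEi : iteratedDeriv i e (k l) = E i k := by
    rw [he, iteratedDeriv_sliceFun_of_chain hE, zero_add, sliceFun_self]
  -- Leibniz for the product of the two reciprocals
  have hgAc' : ContDiffAt ℝ (n - i : ℕ) gA (k l) := (hgAc.of_le (by exact_mod_cast Nat.sub_le n i)).contDiffAt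
  have hgFc' : ContDiffAt ℝ (n - i : ℕ) gF (k l) := (hgFc.of_le (by exact_mod_cast Nat.sub_le n i)).contDiffAt
  rw [hEi, iteratedDeriv_fun_mul hgAc' hgFc', Finset.mul_sum]
  refine Finset.sum_congr rfl fun j _ => ?_
  have hjA : iteratedDeriv j gA (k l) = recipFactor l A a j k / (A 0 k + a) := sliceIterDeriv_inv_eq hAne j k
  have hjF : iteratedDeriv (n - i - j) gF (k l) = recipFactor l F b (n - i - j) k / (F 0 k + b) :=
    sliceIterDeriv_inv_eq hFne _ k
  rw [hjA, hjF]
  ring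

end Leibniz

/-! ## Symbols with smooth periodic slices: the chain and periodicity of `sliceIterDeriv` -/

section Smooth

variable {l : Fin d} {Φ : (Fin d → ℝ) → ℝ}

/-- **The chain property of `m ↦ ∂_l^m Φ`**: if the slices of `Φ` are smooth then
`(d/ds) (∂_l^m Φ)(k[l↦s])|_{s=k_l} = (∂_l^{m+1} Φ)(k)`. [folklore] -/
theorem hasDerivAt_sliceFun_sliceIterDeriv (hΦ : ∀ (k : Fin d → ℝ) (n : ℕ), ContDiff ℝ n (sliceFun l Φ k))
    (m : ℕ) (k : Fin d → ℝ) :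
    HasDerivAt (sliceFun l (sliceIterDeriv l m Φ) k) (sliceIterDeriv l (m + 1) Φ k) (k l) := by
  rw [sliceFun_sliceIterDeriv, sliceIterDeriv, iteratedDeriv_succ]
  exact (((hΦ k (m + 1)).differentiable_iteratedDeriv' m).differentiableAt).hasDerivAt

/-- Iterated derivatives of a periodic function are periodic. [folklore] -/
theorem periodic_iteratedDeriv_real {f : ℝ → ℝ} {c : ℝ} (hf : Function.Periodic f c) (m : ℕ) :
    Function.Periodic (iteratedDeriv m f) c := by
  induction m with
  | zero => simpa using hf
  | succ m ih =>
    intro s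
    rw [iteratedDeriv_succ]
    have h : iteratedDeriv m f = fun x => iteratedDeriv m f (x + c) := funext fun x => (ih x).symm
    have h2 : deriv (iteratedDeriv m f) s = deriv (fun x => iteratedDeriv m f (x + c)) s :=
      congrArg (fun g : ℝ → ℝ => deriv g s) h
    rw [deriv_comp_add_const] at h2
    exact h2.symm

/-- **Periodicity across the faces of the cube**: if `Φ` is `2π`-periodic in `k_l` then so is each
`∂_l^m Φ`, in particular `(∂_l^m Φ)(k[l↦-π]) = (∂_l^m Φ)(k[l↦π])`. [folklore] -/
theorem sliceIterDeriv_update_neg_pi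
    (hper : ∀ k s, Φ (Function.update k l (s + 2 * Real.pi)) = Φ (Function.update k l s)) (m : ℕ)
    (k : Fin d → ℝ) :
    sliceIterDeriv l m Φ (Function.update k l (-Real.pi)) = sliceIterDeriv l m Φ (Function.update k l Real.pi) := by
  rw [sliceIterDeriv_update, sliceIterDeriv_update]
  have hp : Function.Periodic (sliceFun l Φ k) (2 * Real.pi) := fun s => hper k s
  have := periodic_iteratedDeriv_real hp m (-Real.pi)
  rw [show -Real.pi + 2 * Real.pi = Real.pi by ring] at this
  exact this.symm

/-- Continuity of `k ↦ (∂_l^m Φ)(k)` is NOT automatic from slice-wise smoothness; for the symbols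
of the sequel it follows from the explicit expansions above. Here: continuity of the quotient
symbol `E 0/((A 0 + a)(F 0 + b))` itself from that of its constituents. [folklore] -/
theorem continuous_quotient_symbol {A F E : ℕ → (Fin d → ℝ) → ℝ} {a b : ℝ}
    (hAc : Continuous (A 0)) (hFc : Continuous (F 0)) (hEc : Continuous (E 0))
    (hAne : ∀ k, A 0 k + a ≠ 0) (hFne : ∀ k, F 0 k + b ≠ 0) :
    Continuous fun k => E 0 k / ((A 0 k + a) * (F 0 k + b)) :=
  hEc.div ((hAc.add continuous_const).mul (hFc.add continuous_const)) fun k => mul_ne_zero (hAne k) (hFne k)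

/-- Continuity of `∂_l^n [E 0/((A 0 + a)(F 0 + b))]` on `ℝ^d` from the Leibniz expansion, when all
`A j, F j, E j` are continuous. [folklore] -/
theorem continuous_sliceIterDeriv_quotient {A F E : ℕ → (Fin d → ℝ) → ℝ} {a b : ℝ}
    (hA : ∀ j k, HasDerivAt (sliceFun l (A j) k) (A (j + 1) k) (k l))
    (hF : ∀ j k, HasDerivAt (sliceFun l (F j) k) (F (j + 1) k) (k l))
    (hE : ∀ j k, HasDerivAt (sliceFun l (E j) k) (E (j + 1) k) (k l))
    (hAne : ∀ k, A 0 k + a ≠ 0) (hFne : ∀ k, F 0 k + b ≠ 0)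
    (hAc : ∀ j, Continuous (A j)) (hFc : ∀ j, Continuous (F j)) (hEc : ∀ j, Continuous (E j)) (n : ℕ) :
    Continuous (sliceIterDeriv l n (fun k => E 0 k / ((A 0 k + a) * (F 0 k + b)))) := by
  have hfun : sliceIterDeriv l n (fun k => E 0 k / ((A 0 k + a) * (F 0 k + b))) = fun k =>
      ∑ i ∈ range (n + 1), ∑ j ∈ range (n - i + 1), (n.choose i : ℝ) * ((n - i).choose j : ℝ) *
        E i k * (recipFactor l A a j k / (A 0 k + a)) * (recipFactor l F b (n - i - j) k / (F 0 k + b)) :=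
    funext fun k => sliceIterDeriv_quotient_eq_sum hA hF hE hAne hFne n k
  rw [hfun]
  refine continuous_finsetSum _ fun i _ => continuous_finsetSum _ fun j _ => ?_
  refine ((((continuous_const.mul continuous_const).mul (hEc i)).mul
    ((continuous_recipFactor hA hAne hAc j).div ((hAc 0).add continuous_const) hAne)).mul
    ((continuous_recipFactor hF hFne hFc _).div ((hFc 0).add continuous_const) hFne))

end Smooth

end Literature.Barriers.CriticalPhenomena

end
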